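import Summits.AtomisticToContinuum.FouriersLaw.Theorems.BondHeatUncertaintyBoundedResponseStorageLeakA
import HarnessLib

/-!
# NODE 95E «StorageLeak» (lens-1 g95) — part 2 of 2 (sequel of `…BondHeatUncertaintyBoundedResponseStorageLeakA`)

Split for the 400-line cap by the landing lane (hand-2 g36); the module docstring of part 1 (`…StorageLeakA`) describes the whole node.  Same namespace and
sections (`StorageLeak` / `Pinned` re-opened with their `variable` lines); all FQNs unchanged.  0 sorry; standard axioms.
-/

noncomputable section

open MeasureTheory ProbabilityTheory Filter Topology Set Function
open scoped NNReal ENNReal ContDiff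
open Literature.MathematicalPhysics.KineticTheory.HeatConduction
open Literature.MathematicalPhysics.KineticTheory OscillatorChain
open Summit.AtomisticToContinuum.FouriersLaw.Theorems.SubdiffusiveBondHeat
open Summit.AtomisticToContinuum.FouriersLaw.Theorems.OddSectorIrreversibility
open Summit.AtomisticToContinuum.FouriersLaw.Theorems.ExtensiveSnapshotIrreversibility.ClausiusBudget
open Summit.AtomisticToContinuum.FouriersLaw.Theorems.HonestZwanzig
open Summit.AtomisticToContinuum.FouriersLaw.Theorems.BoundedResponse.TransientBand
open Summit.AtomisticToContinuum.FouriersLaw.Cruxes.SuperadditiveResistance.FloatingProbeBypassLaplacian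

namespace Summit.AtomisticToContinuum.FouriersLaw.Theorems.BoundedResponse.ParityFloor

open Summit.AtomisticToContinuum.FouriersLaw.Theses.BondHeatUncertainty (BoundedResponse ExtensiveSnapshotIrreversibility)
open Summit.AtomisticToContinuum.FouriersLaw.Theorems.SubdiffusiveBondHeat.EscapeGrading (OhmicFloor ExponentFloor)
open Summit.AtomisticToContinuum.FouriersLaw.Theorems.BoundedResponse.TransientBand
  (DeficitCesaroPoint TransientFloor TransientCeilingPoint DeficitCesaroGrade)

section StorageLeak

open Summit.AtomisticToContinuum.FouriersLaw.Theorems.SubdiffusiveBondHeat.EscapeGrading (escapeDeficit)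

variable {ω₂ lam β γ T : ℝ}

section Pinned

variable {N : ℕ}

/-! ### §E.5 Identities II: detailed balance for increments, response forms of `S_N`, `F_N`, the ENERGY BALANCE, the size of `S_N` -/

/-- **Detailed balance for corrector increments**: for `t ≥ 0` and `G` strongly measurable with `G² ∈ L¹(μ_T)`,
`∫ G(Θz)·(h₀(z) − P_t h₀(z)) dμ_T = ∫₀ᵗ (∫ θ₀ · P_s G dμ_T) ds` — the shift identity `h₀ − P_t h₀ = ∫₀ᵗ v_s`, Fubini with
the decaying dominant, detailed balance `∫ θ₀·P_s G = ∫ (G∘Θ)·P_s(θ₀∘Θ)` and `θ₀∘Θ = θ₀`. [cite: ReyBellet2006, Lemma 4.2] -/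
theorem integral_flip_mul_increment_eq (hω : 0 < ω₂) (hl : 0 < lam) (hβ : 0 < β) (hγ : 0 < γ) (hN : 0 < N)
    (hT : 0 < T) {G : PhaseSpace N → ℝ} (hGm : StronglyMeasurable G)
    (hG2 : Integrable (fun z => G z ^ 2) ((pinnedChain ω₂ lam β γ).gibbsMeasure N T)) {t : ℝ} (ht : 0 ≤ t) :
    ∫ z, G (z.1, -z.2) * (kinCorrector ω₂ lam β γ T N ⟨0, hN⟩ z - corrAct ω₂ lam β γ T N ⟨0, hN⟩ t z)
        ∂((pinnedChain ω₂ lam β γ).gibbsMeasure N T) =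
      ∫ s in (0 : ℝ)..t, ∫ z, kinObs T N ⟨0, hN⟩ z *
        (∫ y, G y ∂((pinnedChain ω₂ lam β γ).transitionKernel N T T s.toNNReal z))
        ∂((pinnedChain ω₂ lam β γ).gibbsMeasure N T) := by
  set P := pinnedChain ω₂ lam β γ with hP
  haveI : IsProbabilityMeasure (P.gibbsMeasure N T) :=
    pinnedChain_isProbabilityMeasure_gibbsMeasure hω hl.le hβ.le γ N hT
  obtain ⟨hϑ0, h2ϑ, hϑ1⟩ := weight_facts hT
  obtain ⟨K, c, hK, hc, hb⟩ := harrisBound_exists hω hl.le hβ hγ hN hT hϑ0 hϑ1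
  obtain ⟨hθm, hθ2⟩ := kinObs_sq_facts hω hl.le hβ hγ hN hT ⟨0, hN⟩
  rw [intervalIntegral.integral_of_le ht]
  have h1 : ∀ s ∈ Ioc (0 : ℝ) t, ∫ z, kinObs T N ⟨0, hN⟩ z *
      (∫ y, G y ∂(P.transitionKernel N T T s.toNNReal z)) ∂(P.gibbsMeasure N T) =
      ∫ z, G (z.1, -z.2) * kinAct ω₂ lam β γ T N ⟨0, hN⟩ s z ∂(P.gibbsMeasure N T) := fun s _ => by
    have hDB := SubdiffusiveBondHeat.pinnedChain_detailedBalance hω hl hβ hγ hN hT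
      (continuous_kinObs T ⟨0, hN⟩).measurable hGm.measurable hθ2 hG2 s.toNNReal
    refine hDB.trans (integral_congr_ae (Eventually.of_forall fun z => ?_))
    dsimp only
    congr 1
    exact integral_congr_ae (Eventually.of_forall fun y => kinObs_reversal T ⟨0, hN⟩ y)
  rw [setIntegral_congr_fun measurableSet_Ioc h1]
  have hν : Integrable (fun y => Real.exp (2 * (1 / (4 * T)) * P.hamiltonian N y)) (P.gibbsMeasure N T) :=
    pinnedChain_integrable_exp_mul_hamiltonian_gibbsMeasure hω hl.le hβ.le γ N hT h2ϑ
  have hFm : StronglyMeasurable fun z : PhaseSpace N => G (z.1, -z.2) :=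
    hGm.comp_measurable (measurable_fst.prodMk measurable_snd.neg)
  have hF2 : Integrable (fun z : PhaseSpace N => G (z.1, -z.2) ^ 2) (P.gibbsMeasure N T) :=
    integrable_flip_gibbsMeasure P N T (F := fun y => G y ^ 2) hG2
  rw [← integral_mul_setIntegral_kinAct hω hl.le hβ.le hγ.le hT hϑ0 hK.le hb hc ⟨0, hN⟩ (P.gibbsMeasure N T) hν hFm
    hF2 (S := Ioc 0 t) (fun s hs => hs.1)]
  refine integral_congr_ae (Eventually.of_forall fun z => ?_)
  dsimp only
  rw [(increment_facts hω hl.le hβ hγ hN hT ⟨0, hN⟩ ht).2.1 z]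

/-- **Storage in response form**: for `t ≥ 0` and `N ≥ 1`,
`S_N(t) = (1/T²) ∫₀ᵗ ⟨θ₀, P_s(H − ⟨H⟩)⟩_{μ_T} ds` (`H` is even in the momenta). [folklore] -/
theorem storageResponse_eq_intervalIntegral (hω : 0 < ω₂) (hl : 0 < lam) (hβ : 0 < β) (hγ : 0 < γ) (hN : 0 < N)
    (hT : 0 < T) {t : ℝ} (ht : 0 ≤ t) :
    storageResponse ω₂ lam β γ T N t =
      1 / T ^ 2 * ∫ s in (0 : ℝ)..t, ∫ z, kinObs T N ⟨0, hN⟩ z *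
        (∫ y, ((pinnedChain ω₂ lam β γ).hamiltonian N y -
          ∫ x, (pinnedChain ω₂ lam β γ).hamiltonian N x ∂((pinnedChain ω₂ lam β γ).gibbsMeasure N T))
          ∂((pinnedChain ω₂ lam β γ).transitionKernel N T T s.toNNReal z))
        ∂((pinnedChain ω₂ lam β γ).gibbsMeasure N T) := by
  set P := pinnedChain ω₂ lam β γ with hP
  obtain ⟨hHm, -, hH2⟩ := centredHamiltonian_facts hω hl.le hβ hγ hN hT
  rw [storageResponse, dif_pos hN, ← integral_flip_mul_increment_eq hω hl hβ hγ hN hT hHm hH2 ht]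
  congr 1
  refine integral_congr_ae (Eventually.of_forall fun z => ?_)
  dsimp only
  rw [OscillatorChain.hamiltonian_neg_momentum]

/-- **Leak in response form**: for `t ≥ 0` and `N ≥ 2`,
`F_N(t) = (γ/T²)·(∫₀ᵗ ⟨θ₀, h_{N−1}⟩ ds − ∫₀ᵗ ⟨θ₀, P_s h_{N−1}⟩ ds)` — the time-integrated linear response of the far contact
temperature. [folklore] -/
theorem leakResponse_eq_intervalIntegral (hω : 0 < ω₂) (hl : 0 < lam) (hβ : 0 < β) (hγ : 0 < γ) (hN : 2 ≤ N)
    (hT : 0 < T) {t : ℝ} (ht : 0 ≤ t) :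
    leakResponse ω₂ lam β γ T N t =
      γ / T ^ 2 * ((∫ _s in (0 : ℝ)..t, ∫ z, kinObs T N ⟨0, by omega⟩ z * kinCorrector ω₂ lam β γ T N ⟨N - 1, by omega⟩ z
          ∂((pinnedChain ω₂ lam β γ).gibbsMeasure N T)) -
        ∫ s in (0 : ℝ)..t, ∫ z, kinObs T N ⟨0, by omega⟩ z *
          corrAct ω₂ lam β γ T N ⟨N - 1, by omega⟩ s z ∂((pinnedChain ω₂ lam β γ).gibbsMeasure N T)) := by
  set P := pinnedChain ω₂ lam β γ with hP
  have hN0 : 0 < N := by omega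
  obtain ⟨h1m, h12, -, -⟩ := corrector_sq_facts hω hl.le hβ hγ hN0 hT ⟨N - 1, by omega⟩
  rw [leakResponse, dif_pos hN0, escapeDeficit_eq_crossPairing hω hl hβ hγ hN hT, intervalIntegral.integral_const,
    smul_eq_mul, sub_zero, integral_flip_mul_increment_eq hω hl hβ hγ hN0 hT h1m h12 ht]
  simp only [corrAct]
  ring

/-- **Cross response = total transfer − transmitted signal**: for `N ≥ 1`, `s ≥ 0`,
`∫ θ₀ · P_s h_{N−1} dμ_T = ∫ θ₀ · h_{N−1} dμ_T − ∫₀ˢ K×_N(u) du` (the shift identity `P_s h_{N−1} = h_{N−1} − ∫₀ˢ P_u θ_{N−1} du`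
and Fubini with the decaying dominant).  Read with `leakResponse_eq_intervalIntegral` (pointwise in `s` under its `ds`-integral):
`F_N(t) = (γ/T²) ∫₀ᵗ (∫₀ˢ K×_N(u) du) ds` — so (D_F) is a statement about ONE correlation function, the end-to-end kernel: its
second antiderivative at the Thouless time is `O(N)` («no ballistic channel»; for the harmonic member `K×_N` carries mass
`T²E_∞/γ` in ballistic peaks and (D_F) fails). [folklore] -/
theorem integral_kinObs_mul_corrAct_eq (hω : 0 < ω₂) (hl : 0 < lam) (hβ : 0 < β) (hγ : 0 < γ) (hN : 0 < N) (hT : 0 < T)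
    {s : ℝ} (hs : 0 ≤ s) :
    ∫ z, kinObs T N ⟨0, hN⟩ z * corrAct ω₂ lam β γ T N ⟨N - 1, by omega⟩ s z ∂((pinnedChain ω₂ lam β γ).gibbsMeasure N T) =
      (∫ z, kinObs T N ⟨0, hN⟩ z * kinCorrector ω₂ lam β γ T N ⟨N - 1, by omega⟩ z
          ∂((pinnedChain ω₂ lam β γ).gibbsMeasure N T)) -
        ∫ u in (0 : ℝ)..s, crossKernel ω₂ lam β γ T N u := by
  set P := pinnedChain ω₂ lam β γ with hP
  haveI : IsProbabilityMeasure (P.gibbsMeasure N T) :=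
    pinnedChain_isProbabilityMeasure_gibbsMeasure hω hl.le hβ.le γ N hT
  obtain ⟨hϑ0, h2ϑ, hϑ1⟩ := weight_facts hT
  obtain ⟨K, c, hK, hc, hb⟩ := harrisBound_exists hω hl.le hβ hγ hN hT hϑ0 hϑ1
  obtain ⟨hθm, hθ2⟩ := kinObs_sq_facts hω hl.le hβ hγ hN hT ⟨0, hN⟩
  obtain ⟨h1m, h12, -, -⟩ := corrector_sq_facts hω hl.le hβ hγ hN hT ⟨N - 1, by omega⟩
  obtain ⟨hDm, hDs, hD2, -⟩ := increment_facts hω hl.le hβ hγ hN hT ⟨N - 1, by omega⟩ hs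
  have i01 := integrable_mul_of_integrable_sq hθm.aestronglyMeasurable h1m.aestronglyMeasurable hθ2 h12
  have iθD : Integrable (fun z => kinObs T N ⟨0, hN⟩ z *
      ∫ u in Ioc (0 : ℝ) s, kinAct ω₂ lam β γ T N ⟨N - 1, by omega⟩ u z) (P.gibbsMeasure N T) :=
    (integrable_mul_of_integrable_sq hθm.aestronglyMeasurable hDm.aestronglyMeasurable hθ2 hD2).congr
      (Eventually.of_forall fun z => by simp only [hDs z])
  have e1 : ∀ z, kinObs T N ⟨0, hN⟩ z * corrAct ω₂ lam β γ T N ⟨N - 1, by omega⟩ s z =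
      kinObs T N ⟨0, hN⟩ z * kinCorrector ω₂ lam β γ T N ⟨N - 1, by omega⟩ z -
        kinObs T N ⟨0, hN⟩ z * ∫ u in Ioc (0 : ℝ) s, kinAct ω₂ lam β γ T N ⟨N - 1, by omega⟩ u z := fun z => by
    rw [← hDs z]
    ring
  have hν : Integrable (fun y => Real.exp (2 * (1 / (4 * T)) * P.hamiltonian N y)) (P.gibbsMeasure N T) :=
    pinnedChain_integrable_exp_mul_hamiltonian_gibbsMeasure hω hl.le hβ.le γ N hT h2ϑ
  rw [integral_congr_ae (Eventually.of_forall e1), integral_sub i01 iθD,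
    integral_mul_setIntegral_kinAct hω hl.le hβ.le hγ.le hT hϑ0 hK.le hb hc ⟨N - 1, by omega⟩ (P.gibbsMeasure N T) hν
      hθm hθ2 (S := Ioc 0 s) (fun u hu => hu.1), intervalIntegral.integral_of_le hs]
  congr 1
  refine setIntegral_congr_fun measurableSet_Ioc fun u _ => ?_
  rw [crossKernel, dif_pos hN]

/-- **ENERGY BALANCE (first law in linear response).** For `N ≥ 2` and `t ≥ 0`:
`W_N(t) = S_N(t) + F_N(t)` — the heat injected at the hot contact up to time `t` equals the heat stored in the chain plus the
heat passed to the far bath.  Proof: `W_N(t) = t·E_N + escapeTransient_N(t)` (tree), the transient is the pairing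
`(γ/T²)∫ h₀(Θz)(h₀ − P_t h₀)(z) dμ_T`, and `h₀∘Θ = (H − ⟨H⟩)/γ − h_{N−1}∘Θ` a.e. (the pair identity pulled back along `Θ`,
`H∘Θ = H`). [folklore] -/
theorem deficitCesaro_eq_storage_add_leak (hω : 0 < ω₂) (hl : 0 < lam) (hβ : 0 < β) (hγ : 0 < γ) (hN : 2 ≤ N)
    (hT : 0 < T) {t : ℝ} (ht : 0 ≤ t) :
    deficitCesaro ω₂ lam β γ T N t = storageResponse ω₂ lam β γ T N t + leakResponse ω₂ lam β γ T N t := by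
  have hN0 : 0 < N := by omega
  obtain ⟨hDm, -, hD2, -⟩ := increment_facts hω hl.le hβ hγ hN0 hT ⟨0, hN0⟩ ht
  obtain ⟨-, -, h1m, h12⟩ := corrector_sq_facts hω hl.le hβ hγ hN0 hT ⟨N - 1, by omega⟩
  obtain ⟨hHm, -, hH2⟩ := centredHamiltonian_facts hω hl.le hβ hγ hN0 hT
  have iHD := integrable_mul_of_integrable_sq hHm.aestronglyMeasurable hDm.aestronglyMeasurable hH2 hD2
  have i1D := integrable_mul_of_integrable_sq h1m.aestronglyMeasurable hDm.aestronglyMeasurable h12 hD2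
  -- the pair identity pulled back along `Θ`
  have hpair := kinCorrector_pair_ae_eq hω hl.le hβ hγ hN hT
  have hqmp := (measurePreserving_reversal_gibbsMeasure (pinnedChain ω₂ lam β γ) N T).quasiMeasurePreserving
  have hpairΘ := hqmp.ae hpair
  simp only [momentumReversal_apply, OscillatorChain.hamiltonian_neg_momentum] at hpairΘ
  have e2 : ∫ z, kinCorrector ω₂ lam β γ T N ⟨0, hN0⟩ (z.1, -z.2) *
        (kinCorrector ω₂ lam β γ T N ⟨0, hN0⟩ z - corrAct ω₂ lam β γ T N ⟨0, hN0⟩ t z)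
        ∂((pinnedChain ω₂ lam β γ).gibbsMeasure N T) =
      1 / γ * ∫ z, ((pinnedChain ω₂ lam β γ).hamiltonian N z -
            ∫ x, (pinnedChain ω₂ lam β γ).hamiltonian N x ∂((pinnedChain ω₂ lam β γ).gibbsMeasure N T)) *
          (kinCorrector ω₂ lam β γ T N ⟨0, hN0⟩ z - corrAct ω₂ lam β γ T N ⟨0, hN0⟩ t z)
          ∂((pinnedChain ω₂ lam β γ).gibbsMeasure N T) -
        ∫ z, kinCorrector ω₂ lam β γ T N ⟨N - 1, by omega⟩ (z.1, -z.2) *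
          (kinCorrector ω₂ lam β γ T N ⟨0, hN0⟩ z - corrAct ω₂ lam β γ T N ⟨0, hN0⟩ t z)
          ∂((pinnedChain ω₂ lam β γ).gibbsMeasure N T) := by
    rw [← integral_const_mul, ← integral_sub (iHD.const_mul _) i1D]
    refine integral_congr_ae ?_
    filter_upwards [hpairΘ] with z hz
    have hz' : kinCorrector ω₂ lam β γ T N ⟨0, hN0⟩ (z.1, -z.2) =
        ((pinnedChain ω₂ lam β γ).hamiltonian N z -
            ∫ x, (pinnedChain ω₂ lam β γ).hamiltonian N x ∂((pinnedChain ω₂ lam β γ).gibbsMeasure N T)) / γ -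
          kinCorrector ω₂ lam β γ T N ⟨N - 1, by omega⟩ (z.1, -z.2) := by
      rw [← hz]; ring
    rw [hz']
    field_simp
  have e3 : γ / T ^ 2 * ∫ z, kinCorrector ω₂ lam β γ T N ⟨0, hN0⟩ (z.1, -z.2) *
        (kinCorrector ω₂ lam β γ T N ⟨0, hN0⟩ z - corrAct ω₂ lam β γ T N ⟨0, hN0⟩ t z)
        ∂((pinnedChain ω₂ lam β γ).gibbsMeasure N T) =
      1 / T ^ 2 * ∫ z, ((pinnedChain ω₂ lam β γ).hamiltonian N z -
            ∫ x, (pinnedChain ω₂ lam β γ).hamiltonian N x ∂((pinnedChain ω₂ lam β γ).gibbsMeasure N T)) *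
          (kinCorrector ω₂ lam β γ T N ⟨0, hN0⟩ z - corrAct ω₂ lam β γ T N ⟨0, hN0⟩ t z)
          ∂((pinnedChain ω₂ lam β γ).gibbsMeasure N T) -
        γ / T ^ 2 * ∫ z, kinCorrector ω₂ lam β γ T N ⟨N - 1, by omega⟩ (z.1, -z.2) *
          (kinCorrector ω₂ lam β γ T N ⟨0, hN0⟩ z - corrAct ω₂ lam β γ T N ⟨0, hN0⟩ t z)
          ∂((pinnedChain ω₂ lam β γ).gibbsMeasure N T) := by
    rw [e2, mul_sub, ← mul_assoc]
    congr 2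
    field_simp
  rw [deficitCesaro_eq_add hω hl hβ hγ hT N ht, escapeTransient_eq_pairing hω hl hβ hγ hN0 hT ht, e3, storageResponse,
    leakResponse, dif_pos hN0, dif_pos hN0]
  ring

/-- **Size of the storage functional**: for `N ≥ 1`, `t ≥ 0`,
`|S_N(t)| ≤ (1/(2T²))·(∫ (H − ⟨H⟩)² dμ_T + 4 ∫ h₀² dμ_T)` (`2|ab| ≤ a² + b²`, `∫ (h₀ − P_t h₀)² ≤ 4∫ h₀²`). [folklore] -/
theorem abs_storageResponse_le (hω : 0 < ω₂) (hl : 0 ≤ lam) (hβ : 0 < β) (hγ : 0 < γ) (hN : 0 < N) (hT : 0 < T)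
    {t : ℝ} (ht : 0 ≤ t) :
    |storageResponse ω₂ lam β γ T N t| ≤
      1 / (2 * T ^ 2) * ((∫ z, ((pinnedChain ω₂ lam β γ).hamiltonian N z -
          ∫ x, (pinnedChain ω₂ lam β γ).hamiltonian N x ∂((pinnedChain ω₂ lam β γ).gibbsMeasure N T)) ^ 2
          ∂((pinnedChain ω₂ lam β γ).gibbsMeasure N T)) +
        4 * ∫ z, kinCorrector ω₂ lam β γ T N ⟨0, hN⟩ z ^ 2 ∂((pinnedChain ω₂ lam β γ).gibbsMeasure N T)) := by
  set P := pinnedChain ω₂ lam β γ with hP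
  set m : ℝ := ∫ x, P.hamiltonian N x ∂(P.gibbsMeasure N T) with hm
  obtain ⟨hDm, -, hD2, hD4⟩ := increment_facts hω hl hβ hγ hN hT ⟨0, hN⟩ ht
  obtain ⟨hHm, -, hH2⟩ := centredHamiltonian_facts hω hl hβ hγ hN hT
  have iHD := integrable_mul_of_integrable_sq hHm.aestronglyMeasurable hDm.aestronglyMeasurable hH2 hD2
  have hT2 : 0 < T ^ 2 := by positivity
  have h1 : |∫ z, (P.hamiltonian N z - m) *
        (kinCorrector ω₂ lam β γ T N ⟨0, hN⟩ z - corrAct ω₂ lam β γ T N ⟨0, hN⟩ t z) ∂(P.gibbsMeasure N T)| ≤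
      ((∫ z, (P.hamiltonian N z - m) ^ 2 ∂(P.gibbsMeasure N T)) +
        ∫ z, (kinCorrector ω₂ lam β γ T N ⟨0, hN⟩ z - corrAct ω₂ lam β γ T N ⟨0, hN⟩ t z) ^ 2
          ∂(P.gibbsMeasure N T)) / 2 := by
    refine (abs_integral_le_integral_abs).trans ?_
    rw [← integral_add hH2 hD2, ← integral_div]
    refine integral_mono iHD.abs ((hH2.add hD2).div_const 2) fun z => ?_
    rw [abs_mul]
    nlinarith [sq_nonneg (|P.hamiltonian N z - m| -
      |kinCorrector ω₂ lam β γ T N ⟨0, hN⟩ z - corrAct ω₂ lam β γ T N ⟨0, hN⟩ t z|),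
      sq_abs (P.hamiltonian N z - m), sq_abs (kinCorrector ω₂ lam β γ T N ⟨0, hN⟩ z - corrAct ω₂ lam β γ T N ⟨0, hN⟩ t z)]
  rw [storageResponse, dif_pos hN, abs_mul, abs_of_pos (by positivity : (0 : ℝ) < 1 / T ^ 2)]
  calc 1 / T ^ 2 * |∫ z, (P.hamiltonian N z - m) *
          (kinCorrector ω₂ lam β γ T N ⟨0, hN⟩ z - corrAct ω₂ lam β γ T N ⟨0, hN⟩ t z) ∂(P.gibbsMeasure N T)|
      ≤ 1 / T ^ 2 * (((∫ z, (P.hamiltonian N z - m) ^ 2 ∂(P.gibbsMeasure N T)) +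
          ∫ z, (kinCorrector ω₂ lam β γ T N ⟨0, hN⟩ z - corrAct ω₂ lam β γ T N ⟨0, hN⟩ t z) ^ 2
            ∂(P.gibbsMeasure N T)) / 2) := by gcongr
    _ ≤ 1 / T ^ 2 * (((∫ z, (P.hamiltonian N z - m) ^ 2 ∂(P.gibbsMeasure N T)) +
          4 * ∫ z, kinCorrector ω₂ lam β γ T N ⟨0, hN⟩ z ^ 2 ∂(P.gibbsMeasure N T)) / 2) := by gcongr
    _ = _ := by ring

end Pinned

/-! ### §E.6 The cut of (D): seam, doors, and the necessity of (D_F) -/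

/-- **SEAM: (D) ⟸ (D_S) ∧ (D_F)** — `W_N(cN²) = S_N(cN²) + F_N(cN²) ≤ (C_S + C_F)·N`. [folklore] -/
theorem deficitCesaroPoint_of_storageBound_leakPoint : StorageBound → LeakPoint → DeficitCesaroPoint := by
  intro hS hF ω₂ lam β γ hω hl hβ hγ T hT
  obtain ⟨C₁, N₁, h₁⟩ := hS ω₂ lam β γ hω hl hβ hγ T hT
  obtain ⟨C₂, c, hc, N₂, h₂⟩ := hF ω₂ lam β γ hω hl hβ hγ T hT
  refine ⟨C₁ + C₂, c, hc, max (max N₁ N₂) 2, fun N hN => ?_⟩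
  have hN₁ : N₁ ≤ N := le_trans (le_trans (le_max_left _ _) (le_max_left _ _)) hN
  have hN₂ : N₂ ≤ N := le_trans (le_trans (le_max_right _ _) (le_max_left _ _)) hN
  have hN2 : 2 ≤ N := le_trans (le_max_right _ _) hN
  have ht : 0 ≤ c * (N : ℝ) ^ 2 := by positivity
  rw [deficitCesaro_eq_storage_add_leak hω hl hβ hγ hN2 hT ht, add_mul]
  exact add_le_add (h₁ N hN₁ _ ht) (h₂ N hN₂)

/-- **DOOR: 11071 ⟸ (D_F) ∧ (D_S) ∧ (F₁)** — the seam and `boundedResponse_of_deficitCesaroPoint_transientFloor` (tree). [folklore] -/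
theorem boundedResponse_of_leakPoint_storageBound_transientFloor :
    LeakPoint → StorageBound → TransientFloor 1 → BoundedResponse := fun hF hS hT1 =>
  boundedResponse_of_deficitCesaroPoint_transientFloor (deficitCesaroPoint_of_storageBound_leakPoint hS hF) hT1

/-- **(D_S) ⟸ (V) ∧ (C₁)**: `S_N(t) ≤ |S_N(t)| ≤ (1/(2T²))(C_V·N + 4C_h·N)`. [folklore] -/
theorem storageBound_of_grades : EnergyFluctuationExtensive → CorrectorGrade 1 → StorageBound := by
  intro hV hC ω₂ lam β γ hω hl hβ hγ T hT
  obtain ⟨C₁, h₁⟩ := hV ω₂ lam β γ hω hl hβ hγ T hT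
  obtain ⟨C₂, N₂, h₂⟩ := hC ω₂ lam β γ hω hl hβ hγ T hT
  refine ⟨1 / (2 * T ^ 2) * (C₁ + 4 * C₂), max N₂ 1, fun N hN t ht => ?_⟩
  have hN0 : 0 < N := lt_of_lt_of_le Nat.one_pos (le_trans (le_max_right _ _) hN)
  have hN₂ : N₂ ≤ N := le_trans (le_max_left _ _) hN
  have hb := abs_storageResponse_le hω hl.le hβ hγ hN0 hT ht
  have h2' := h₂ N hN0 hN₂
  rw [Real.rpow_one] at h2'
  calc storageResponse ω₂ lam β γ T N t ≤ |storageResponse ω₂ lam β γ T N t| := le_abs_self _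
    _ ≤ _ := hb
    _ ≤ 1 / (2 * T ^ 2) * (C₁ * N + 4 * (C₂ * N)) := by gcongr; exact h₁ N
    _ = _ := by ring

/-- **(C_s) ⟹ (O_s)**: `oddDefect(μ_T) h = (γ²/T⁴)∫ (h₀ − h₀∘Θ)² ≤ (4γ²/T⁴) ∫ h₀²` for every response density `h`
(`oddDefect_eq_of_isResponseDensity`, `Θ`-invariance of `μ_T`). [folklore] -/
theorem oddSnapshotGrade_of_correctorGrade {s : ℝ} : CorrectorGrade s → OddSnapshotGrade s := by
  intro hC ω₂ lam β γ hω hl hβ hγ hU μ hμ T hT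
  obtain ⟨C, N₀, hC'⟩ := hC ω₂ lam β γ hω hl hβ hγ T hT
  refine ⟨4 * γ ^ 2 / T ^ 4 * C, max N₀ 2, fun N h hN hh => ?_⟩
  have hN2 : 2 ≤ N := le_trans (le_max_right _ _) hN
  have hN₀ : N₀ ≤ N := le_trans (le_max_left _ _) hN
  have hN0 : 0 < N := by omega
  set P := pinnedChain ω₂ lam β γ with hP
  obtain ⟨h0m, h02, h0m', h02'⟩ := corrector_sq_facts hω hl.le hβ hγ hN0 hT ⟨0, hN0⟩
  have ia2 : ∫ z, kinCorrector ω₂ lam β γ T N ⟨0, hN0⟩ (z.1, -z.2) ^ 2 ∂(P.gibbsMeasure N T) =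
      ∫ z, kinCorrector ω₂ lam β γ T N ⟨0, hN0⟩ z ^ 2 ∂(P.gibbsMeasure N T) :=
    integral_flip_gibbsMeasure P N T (fun y => kinCorrector ω₂ lam β γ T N ⟨0, hN0⟩ y ^ 2)
  have hdiff : Integrable (fun z => (kinCorrector ω₂ lam β γ T N ⟨0, hN0⟩ z -
      kinCorrector ω₂ lam β γ T N ⟨0, hN0⟩ (z.1, -z.2)) ^ 2) (P.gibbsMeasure N T) := by
    refine ((h02.const_mul 2).add (h02'.const_mul 2)).mono' ((h0m.sub h0m').aestronglyMeasurable.pow 2)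
      (Eventually.of_forall fun z => ?_)
    rw [Real.norm_eq_abs, abs_of_nonneg (sq_nonneg _), Pi.add_apply]
    nlinarith [sq_nonneg (kinCorrector ω₂ lam β γ T N ⟨0, hN0⟩ z + kinCorrector ω₂ lam β γ T N ⟨0, hN0⟩ (z.1, -z.2))]
  have hle : ∫ z, (kinCorrector ω₂ lam β γ T N ⟨0, hN0⟩ z - kinCorrector ω₂ lam β γ T N ⟨0, hN0⟩ (z.1, -z.2)) ^ 2
        ∂(P.gibbsMeasure N T) ≤
      4 * ∫ z, kinCorrector ω₂ lam β γ T N ⟨0, hN0⟩ z ^ 2 ∂(P.gibbsMeasure N T) := by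
    calc ∫ z, (kinCorrector ω₂ lam β γ T N ⟨0, hN0⟩ z - kinCorrector ω₂ lam β γ T N ⟨0, hN0⟩ (z.1, -z.2)) ^ 2
          ∂(P.gibbsMeasure N T)
        ≤ ∫ z, (2 * kinCorrector ω₂ lam β γ T N ⟨0, hN0⟩ z ^ 2 +
            2 * kinCorrector ω₂ lam β γ T N ⟨0, hN0⟩ (z.1, -z.2) ^ 2) ∂(P.gibbsMeasure N T) := by
          refine integral_mono hdiff ((h02.const_mul 2).add (h02'.const_mul 2)) fun z => ?_
          dsimp only
          nlinarith [sq_nonneg (kinCorrector ω₂ lam β γ T N ⟨0, hN0⟩ z +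
            kinCorrector ω₂ lam β γ T N ⟨0, hN0⟩ (z.1, -z.2))]
      _ = _ := by
          rw [integral_add (h02.const_mul 2) (h02'.const_mul 2), integral_const_mul, integral_const_mul, ia2]
          ring
  rw [oddDefect_eq_of_isResponseDensity hω hl hβ hγ hU hμ hT hN2 hh]
  have hg : 0 ≤ γ ^ 2 / T ^ 4 := by positivity
  calc γ ^ 2 / T ^ 4 * ∫ z, (kinCorrector ω₂ lam β γ T N ⟨0, hN0⟩ z -
          kinCorrector ω₂ lam β γ T N ⟨0, hN0⟩ (z.1, -z.2)) ^ 2 ∂(P.gibbsMeasure N T)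
      ≤ γ ^ 2 / T ^ 4 * (4 * ∫ z, kinCorrector ω₂ lam β γ T N ⟨0, hN0⟩ z ^ 2 ∂(P.gibbsMeasure N T)) :=
        mul_le_mul_of_nonneg_left hle hg
    _ ≤ γ ^ 2 / T ^ 4 * (4 * (C * (N : ℝ) ^ s)) := by gcongr; exact hC' N hN0 hN₀
    _ = _ := by ring

/-- **DOOR′: 11071 ⟸ (D_F) ∧ (V) ∧ (C₁)** — no (K): `CorrectorGrade 1` gives both (D_S) (with (V)) and `TransientFloor 1`
(`oddSnapshotGrade_of_correctorGrade`, `transientFloor_of_grade`). [folklore] -/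
theorem boundedResponse_of_leakPoint_grades :
    LeakPoint → EnergyFluctuationExtensive → CorrectorGrade 1 → BoundedResponse := fun hF hV hC =>
  boundedResponse_of_leakPoint_storageBound_transientFloor hF (storageBound_of_grades hV hC)
    (transientFloor_of_grade (oddSnapshotGrade_of_correctorGrade hC))

/-- **DOOR″: 11071 ⟸ (D_F) ∧ (D_S) ∧ (L₂) ∧ (K)** — the seam, `transientFloor_one_of_snapshotKL` (tree: (L) proved, so
(L₂) ∧ (K) ⟹ `TransientFloor 1`); (L₂) `SnapshotKLLowerExpansion` is proved in the cell's node 95S (landing queued), after which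
this door reads `11071 ⟸ (D_F) ∧ (D_S) ∧ (K)`. [folklore] -/
theorem boundedResponse_of_leakPoint_storageBound_snapshotKL :
    LeakPoint → StorageBound → SnapshotKLLowerExpansion → ExtensiveSnapshotIrreversibility → BoundedResponse :=
  fun hF hS hL₂ hK => boundedResponse_of_leakPoint_storageBound_transientFloor hF hS (transientFloor_one_of_snapshotKL hL₂ hK)

/-- **(D_F) is necessary modulo phonon-true pieces, I**: `(D) ∧ (V) ∧ (C₁) ⟹ (D_F)` (`F = W − S ≤ W + |S|`). [folklore] -/
theorem leakPoint_of_deficitCesaroPoint_grades :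
    DeficitCesaroPoint → EnergyFluctuationExtensive → CorrectorGrade 1 → LeakPoint := by
  intro hD hV hC ω₂ lam β γ hω hl hβ hγ T hT
  obtain ⟨C₀, c, hc, N₀, h₀⟩ := hD ω₂ lam β γ hω hl hβ hγ T hT
  obtain ⟨C₁, h₁⟩ := hV ω₂ lam β γ hω hl hβ hγ T hT
  obtain ⟨C₂, N₂, h₂⟩ := hC ω₂ lam β γ hω hl hβ hγ T hT
  refine ⟨C₀ + 1 / (2 * T ^ 2) * (C₁ + 4 * C₂), c, hc, max (max N₀ N₂) 2, fun N hN => ?_⟩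
  have hN₀ : N₀ ≤ N := le_trans (le_trans (le_max_left _ _) (le_max_left _ _)) hN
  have hN₂ : N₂ ≤ N := le_trans (le_trans (le_max_right _ _) (le_max_left _ _)) hN
  have hN2 : 2 ≤ N := le_trans (le_max_right _ _) hN
  have hN0 : 0 < N := by omega
  have ht : 0 ≤ c * (N : ℝ) ^ 2 := by positivity
  have hW := h₀ N hN₀
  rw [deficitCesaro_eq_storage_add_leak hω hl hβ hγ hN2 hT ht] at hW
  have hb := abs_storageResponse_le hω hl.le hβ hγ hN0 hT ht
  have h2' := h₂ N hN0 hN₂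
  rw [Real.rpow_one] at h2'
  have hS : |storageResponse ω₂ lam β γ T N (c * (N : ℝ) ^ 2)| ≤ 1 / (2 * T ^ 2) * (C₁ * N + 4 * (C₂ * N)) := by
    calc |storageResponse ω₂ lam β γ T N (c * (N : ℝ) ^ 2)| ≤ _ := hb
      _ ≤ _ := by gcongr; exact h₁ N
  have hS' := neg_abs_le (storageResponse ω₂ lam β γ T N (c * (N : ℝ) ^ 2))
  nlinarith

/-- **(D_F) is necessary modulo phonon-true pieces, II**: `BoundedResponse ∧ TransientCeilingPoint ∧ (V) ∧ (C₁) ⟹ (D_F)`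
(`deficitCesaroPoint_of_ohmicFloor_transientCeiling`, tree).  So (D_F) ≡ 11071 modulo {(U), (V), (C₁)}. [folklore] -/
theorem leakPoint_of_boundedResponse :
    BoundedResponse → TransientCeilingPoint → EnergyFluctuationExtensive → CorrectorGrade 1 → LeakPoint :=
  fun hB hU hV hC => leakPoint_of_deficitCesaroPoint_grades
    (deficitCesaroPoint_of_ohmicFloor_transientCeiling (EscapeGrading.ohmicFloor_iff_boundedResponse.mpr hB) hU) hV hC

end StorageLeak

end Summit.AtomisticToContinuum.FouriersLaw.Theorems.BoundedResponse.ParityFloor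

end
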